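import Mathlib
import Literature.AlgebraicGeometry.Resolution.CobordantGame
import Literature.AlgebraicGeometry.Resolution.CobordantVertexChart
import Literature.AlgebraicGeometry.Resolution.FormalInverseFunction
import Summits.ResolutionOfSingularities.ResolutionOfSingularities.Theorems.WeightedInvariantLocalWeightedDropGradedSliceWildOrbitSubst

/-!
# `WeightedInvariant.LocalWeightedDrop`: the wild slice at rank `0`, part 4 — **no singular successor for the slice ⇒ none for the
# successor** at a wild frozen coordinate of minimal valuation (`gradedWonBy_zero_of_slice_wild`)

Route `ResolutionOfSingularities/WeightedInvariant`, crux `LocalWeightedDrop` (stmt-ResolutionOfSingularities-8899).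
[OURS · L1 W4.3] — res-type-099 (gen 13), res-L1-w43-plan-1 DEALS gen 10 #4 (2) / res-type-060 NAMING 10:55:26Z «099 TAKE (a)»:
**(S3), the RANK-`0` FLOOR of the repaired wild slice clause** of the graded-slice line (ideator res-L1-w43-idea-1).  Signature
= res-type-060's (S3) with the common binders of the repaired clause (`hfac`, `c_v ≠ 0 < w_v`, `q = p^e ∣ w_v`, `(w_v/q : k) ≠ 0`,
`q ∣ wⱼ` for every translated `j`).  Companions: tame half `gradedWonBy_of_slice_tame` (p515424), Frobenius-cover form
`gradedWonBy_wildLambdaFrob_of_slice` and the reduction to descent (p525479), non-minimal-valuation refutation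
`not_gradedWonBy_of_slice_wild_naive` (p523464).  Nothing here is a statement of the manuscript under review on ladder RESOLUTION;
the statements are OURS (the graded game of the line); not a verdict on card A.  AI proof, weaker than expert review.

* §8 `not_isSuccessorAt_of_frobCover` — ONE-MOVE WINS DESCEND along the Frobenius cover for positions `GΘ` with
  `GΘ(…, y_v^q) = (1+y_v)ᵃ·H((1+y_v)^τ x)`: a successor of `GΘ` under `(id, (W,0))`, pulled back to the cover, is the unit times the
  orbit-substitution image of a successor of `H` under `(id, W)` — same `s`-order, same constant term, same linear coefficients off
  `y_v` — so «no singular successor for `H` ⇒ none for `GΘ`».  (General Frobenius descent of wins is false — `…GradedSliceWildProbes`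
  —; what descends here is a WIN BY A PULLED-BACK MOVE.)
* §9 `weight_functional_modEq_zero` (the propagated lattice refines `v_s − Σ wⱼ v_{yⱼ} ≡ 0 mod q` when all translated weights are
  multiples of `q`), `resExp_lt`, `resExp_add_eq`, and **`gradedWonBy_zero_of_slice_wild`**: slice graded-won in ONE move ⇒
  successor graded-won in ONE move.  The `α = 0` case of the (open) same-rank stub (W-min); higher ranks are NOT claimed — there the
  conjugated cover strategy is no longer a pulled-back one (res-type-060 memo §3).
-/

set_option linter.dupNamespace false -- mandated namespace of this single-conjunct summit
set_option autoImplicit false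

namespace Summit.ResolutionOfSingularities.ResolutionOfSingularities.Theorems

namespace GradedGame

open MvPowerSeries
open Literature.AlgebraicGeometry.Resolution

variable {k : Type} [Field k]

/-! ## §8 No singular successor for the conjugated position -/

section Transfer

variable {n : ℕ}

/-- **ONE-MOVE WINS DESCEND ALONG THE FROBENIUS COVER FOR THE CONJUGATED POSITION.**  Let `GΘ ∈ k[[s, y', y_v]]` satisfy
`GΘ(…, y_v^q) = (1+y_v)ᵃ · H((1+y_v)^{τ} x)` for a slice germ `H ∈ k[[s, y']]` which has NO singular successor under the pure
weighted blow-up `(id, W)`.  Then `GΘ` has no singular successor under `(id, (W, 0))`: the successor of `GΘ` at `(c', ·)` pulled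
back to the cover is, up to the unit `(1+y_v)ᵃ`, the image of the successor of `H` at `c'` under the ORBIT SUBSTITUTION `𝒪`
(same `s`-order — `𝒪` fixes `s` and `s ∤` is preserved —, same constant term, same linear coefficients off `y_v`).
[OURS · L1 W4.3] -/
theorem not_isSuccessorAt_of_frobCover (q : ℕ) (hq : 0 < q) (τ : Fin (n + 1) → ℕ) (a : ℕ)
    (GΘ : MvPowerSeries (Fin (n + 1 + 1)) k) (H : MvPowerSeries (Fin (n + 1)) k)
    (hkey : subst (frobFamily (k := k) n q) GΘ = (1 + X (Fin.last (n + 1))) ^ a * subst (scaleFam (k := k) τ) H)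
    (W : Fin (n + 1) → ℕ)
    (hH : ∀ (c' : Fin (n + 1) → k) (A : ℕ) (h₁ : MvPowerSeries (Fin (n + 1 + 1)) k), (∃ i, 0 < W i ∧ c' i ≠ 0) →
      subst (CobordantGame.cruxChart k W c') H = X 0 ^ A * h₁ → ¬ X 0 ∣ h₁ →
      ¬ (constantCoeff h₁ = 0 ∧ ∀ j, coeff (Finsupp.single j 1) h₁ = 0))
    (cb : Fin (n + 1 + 1) → k) (A : ℕ) (S : MvPowerSeries (Fin (n + 1 + 1 + 1)) k) :
    ¬ IsSuccessorAt GΘ (fun i => X i) (Fin.snoc W 0 : Fin (n + 1 + 1) → ℕ) cb A S := by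
  classical
  rintro ⟨⟨i, hwi, hci⟩, hfac, hndvd, hsing⟩
  -- the exceptional point restricted to the slice is off the vertex
  set c' : Fin (n + 1) → k := fun m => cb (Fin.castSucc m) with hc'
  have hoff : ∃ i, 0 < W i ∧ c' i ≠ 0 := by
    revert hwi hci
    refine Fin.lastCases ?_ (fun i' => ?_) i
    · intro hwi; simp at hwi
    · intro hwi hci
      rw [Fin.snoc_castSucc] at hwi
      exact ⟨i', hwi, hci⟩
  -- the chart of the big move and the Frobenius cover of the successor variables commute
  set Ch := CobordantGame.cruxChart k (Fin.snoc W 0 : Fin (n + 1 + 1) → ℕ) cb with hCh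
  have hChs : HasSubst Ch := hasSubst_cruxChart _ cb
  have hFs := hasSubst_frobFamily (k := k) (n := n) q hq
  have hF's := hasSubst_frobFamily (k := k) (n := n + 1) q hq
  have hself : subst (fun i : Fin (n + 1 + 1) => (X i : MvPowerSeries (Fin (n + 1 + 1)) k)) GΘ = GΘ := by
    rw [show (fun i : Fin (n + 1 + 1) => (X i : MvPowerSeries (Fin (n + 1 + 1)) k)) = X from rfl, subst_self]; rfl
  rw [hself] at hfac
  have hChlast : Ch (Fin.last (n + 1)) = X (Fin.last (n + 1 + 1)) := by
    rw [hCh, cruxChart_of_eq_zero _ _ _ (by simp), Fin.succ_last]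
  have hChcs : ∀ m : Fin (n + 1), subst (frobFamily (k := k) (n + 1) q) (Ch (Fin.castSucc m)) = Ch (Fin.castSucc m) := by
    intro m
    have hsucc : (Fin.castSucc m).succ = Fin.castSucc m.succ := (Fin.succ_castSucc m).symm
    have hne0 : (0 : Fin (n + 1 + 1 + 1)) ≠ Fin.last (n + 1 + 1) := by rw [← Fin.succ_last]; exact (Fin.succ_ne_zero _).symm
    rw [hCh]
    unfold CobordantGame.cruxChart
    simp only [Fin.snoc_castSucc, hsucc]
    split_ifs
    · rw [subst_mul hF's, subst_pow hF's, subst_add hF's, subst_C, subst_X hF's, subst_X hF's]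
      simp [frobFamily, hne0]
    · rw [subst_X hF's]
      simp [frobFamily]
  have hcomm : (fun j => subst (frobFamily (k := k) (n + 1) q) (Ch j)) = fun j => subst Ch (frobFamily (k := k) n q j) := by
    funext j
    refine Fin.lastCases ?_ (fun m => ?_) j
    · rw [hChlast, subst_X hF's]
      have : frobFamily (k := k) n q (Fin.last (n + 1)) = X (Fin.last (n + 1)) ^ q := by simp [frobFamily]
      rw [this, subst_pow hChs, subst_X hChs, hChlast]
      simp [frobFamily]
    · rw [hChcs]
      have : frobFamily (k := k) n q (Fin.castSucc m) = X (Fin.castSucc m) := by simp [frobFamily, (Fin.castSucc_lt_last m).ne]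
      rw [this, subst_X hChs]
  -- pull the factorisation back to the cover
  have hcov : X 0 ^ A * subst (frobFamily (k := k) (n + 1) q) S =
      (1 + X (Fin.last (n + 1 + 1))) ^ a * subst (orbitSubst (k := k) τ W c') (subst (CobordantGame.cruxChart k W c') H) := by
    have h := congrArg (subst (frobFamily (k := k) (n + 1) q)) hfac
    rw [subst_mul hF's, subst_pow hF's, subst_X hF's] at h
    have hX0 : frobFamily (k := k) (n + 1) q 0 = X 0 := by
      have hne0 : (0 : Fin (n + 1 + 1 + 1)) ≠ Fin.last (n + 1 + 1) := by rw [← Fin.succ_last]; exact (Fin.succ_ne_zero _).symm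
      simp [frobFamily, hne0]
    rw [hX0, subst_comp_subst_apply hChs hF's, hcomm, ← subst_comp_subst_apply hFs hChs, hkey, subst_mul hChs, subst_pow hChs,
      subst_add hChs, subst_X hChs, hChlast, subst_comp_subst_apply (hasSubst_scaleFam τ) hChs] at h
    have h1 : subst Ch (1 : MvPowerSeries (Fin (n + 1 + 1)) k) = 1 := by rw [← coe_substAlgHom hChs, map_one]
    rw [h1] at h
    rw [← h, subst_comp_subst_apply (hasSubst_cruxChart W c') (hasSubst_orbitSubst τ W c')]
    congr 2
    funext m
    rw [scaleFam, subst_mul hChs, subst_pow hChs, subst_add hChs, h1, subst_X hChs, subst_X hChs, hChlast,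
      subst_orbitSubst_cruxChart τ W c' cb (fun m => rfl) m]
  set HC := subst (CobordantGame.cruxChart k W c') H with hHC
  have hU : IsUnit (((1 : MvPowerSeries (Fin (n + 1 + 1 + 1)) k) + X (Fin.last (n + 1 + 1))) ^ a) := by
    refine IsUnit.pow a (isUnit_iff_constantCoeff.mpr ?_)
    simp [constantCoeff_X]
  by_cases hHC0 : HC = 0
  · -- then the successor vanishes, contradicting `s ∤ S`
    rw [hHC0, ← coe_substAlgHom (hasSubst_orbitSubst τ W c'), map_zero, mul_zero] at hcov
    have hS0 : subst (frobFamily (k := k) (n + 1) q) S = 0 := by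
      rcases mul_eq_zero.mp hcov with h | h
      · exact absurd h (pow_ne_zero _ X_zero_ne_zero)
      · exact h
    apply hndvd
    have : S = 0 := subst_frobFamily_injective (n + 1) q hq (by rw [hS0, ← coe_substAlgHom hF's, map_zero])
    rw [this]; exact dvd_zero _
  · obtain ⟨A', h₁, hfac₁, hnd₁⟩ := CobordantVertexChart.exists_eq_X_pow_mul_not_dvd hHC0
    have hns : ¬ (constantCoeff h₁ = 0 ∧ ∀ j, coeff (Finsupp.single j 1) h₁ = 0) := hH c' A' h₁ hoff hfac₁ hnd₁
    rw [hfac₁, subst_mul (hasSubst_orbitSubst τ W c'), subst_pow (hasSubst_orbitSubst τ W c'), subst_X (hasSubst_orbitSubst τ W c')]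
      at hcov
    have hO0 : orbitSubst (k := k) τ W c' 0 = X 0 := by simp [orbitSubst]
    rw [hO0] at hcov
    have hcov' : X 0 ^ A * subst (frobFamily (k := k) (n + 1) q) S =
        X 0 ^ A' * ((1 + X (Fin.last (n + 1 + 1))) ^ a * subst (orbitSubst (k := k) τ W c') h₁) := by rw [hcov]; ring
    obtain ⟨-, hSO⟩ := eq_of_X_pow_mul_eq hcov' (not_X_dvd_subst_frobFamily (n + 1) q hq hndvd)
      (not_X_dvd_unit_mul hU (not_X_dvd_subst_orbitSubst τ W c' hnd₁))
    have hS' := singular_subst_frobFamily (n + 1) q hq hsing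
    rw [hSO, singular_iff_two_le_order, two_le_order_unit_mul_iff hU, ← singular_iff_two_le_order] at hS'
    exact not_singular_subst_orbitSubst τ W c' hns hS'

end Transfer

/-! ## §9 Lattice arithmetic at the wild point and the rank-`0` theorem -/

section Main

variable {n : ℕ} (w : Fin (n + 1) → ℕ) (c : Fin (n + 1) → k) (q : ℕ)

/-- On the propagated lattice of a point all of whose translated weights are multiples of `q`, the weight functional
`v ↦ v_s − Σ_j w_j v_{y_j}` is `≡ 0 (mod q)`. [OURS · L1 W4.3] -/
theorem weight_functional_modEq_zero (L : AddSubgroup (Fin (n + 1) → ℤ)) (hdvd : ∀ j, c j ≠ 0 → 0 < w j → q ∣ w j)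
    (v : Fin (n + 1 + 1) → ℤ) (hv : v ∈ succLattice L w c) :
    ((v 0 - ∑ j, (w j : ℤ) * v j.succ : ℤ) : ZMod q) = 0 := by
  let φ : (Fin (n + 1 + 1) → ℤ) →+ ZMod q :=
    { toFun := fun v => ((v 0 - ∑ j, (w j : ℤ) * v j.succ : ℤ) : ZMod q)
      map_zero' := by simp
      map_add' := fun u v => by
        simp only [Pi.add_apply, mul_add, Finset.sum_add_distrib]
        push_cast; ring }
  have hle : succLattice L w c ≤ φ.ker := by
    unfold succLattice
    rw [AddSubgroup.closure_le]
    rintro u (⟨r, -, rfl⟩ | ⟨j, hcj, hwj, rfl⟩)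
    · rw [SetLike.mem_coe, AddMonoidHom.mem_ker]
      show (((Matrix.vecCons (∑ j, (w j : ℤ) * r j) r : Fin (n + 1 + 1) → ℤ) 0 -
          ∑ j, (w j : ℤ) * (Matrix.vecCons (∑ j, (w j : ℤ) * r j) r : Fin (n + 1 + 1) → ℤ) j.succ : ℤ) : ZMod q) = 0
      simp
    · rw [SetLike.mem_coe, AddMonoidHom.mem_ker]
      show (((Pi.single j.succ (1 : ℤ) : Fin (n + 1 + 1) → ℤ) 0 -
          ∑ l, (w l : ℤ) * (Pi.single j.succ (1 : ℤ) : Fin (n + 1 + 1) → ℤ) l.succ : ℤ) : ZMod q) = 0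
      rw [Pi.single_eq_of_ne (Fin.succ_ne_zero j).symm, zero_sub]
      rw [Finset.sum_eq_single j]
      · rw [Pi.single_eq_same, mul_one]
        obtain ⟨t, ht⟩ := hdvd j hcj hwj
        push_cast
        rw [ht]; push_cast; rw [ZMod.natCast_self, zero_mul, neg_zero]
      · intro l _ hl
        rw [Pi.single_eq_of_ne (fun h => hl (Fin.succ_injective _ h)), mul_zero]
      · intro h; exact absurd (Finset.mem_univ _) h
  exact (AddMonoidHom.mem_ker).mp (hle hv)

/-- `resExp < q` for `q ≥ 1`. [OURS · L1 W4.3] -/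
theorem resExp_lt (hq : 0 < q) (j : Fin (n + 1)) : resExp w q j < q := by
  unfold resExp ceilExp
  have h1 := Nat.div_add_mod (w j + q - 1) q
  have h2 := Nat.mod_lt (w j + q - 1) hq
  have h3 := le_mul_ceilDiv (w j) q hq
  omega

/-- `resExp ≡ −w (mod q)`: `resExp + w = q⌈w/q⌉`. [OURS · L1 W4.3] -/
theorem resExp_add_eq (hq : 0 < q) (j : Fin (n + 1)) : resExp w q j + w j = q * ceilExp w q j := by
  unfold resExp
  have := le_mul_ceilDiv (w j) q hq
  unfold ceilExp at this ⊢
  omega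

/-- **THE RANK-`0` FLOOR OF THE WILD SLICE CLAUSE (minimal-valuation form): «no singular successor for the slice ⇒ none for the
successor».**  At a frozen coordinate `v` = last with `c_v ≠ 0 < w_v`, `q = p^e ∣ w_v`, `(w_v/q : k) ≠ 0` and `q ∣ wⱼ` for every
translated `j` (res-type-060's repaired hypotheses, WILD-SLICE-CLAUSE.md §0), if the slice `g|_{y_v=0}` is won in ONE graded move
for the slice lattice, then the successor `g` is won in ONE graded move for the propagated lattice `succLattice L w c`.  Proof: the
COMMUTATION LEMMA — the slice's move `θ` conjugated by the formal `q`-th root of the orbit scaling is an honest graded coordinate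
change `Θ` of `k[[s, y', y_v]]` (`conjMove`; it is defined over `k[[y_v]]` because the slice lattice refines the weight congruence
`χ ≡ 0 mod q`, `weight_functional_modEq_zero`), with `(G∘Θ)(…, y_v^q) = (1+y_v)ᵃ·(h∘θ)((1+y_v)^τ x)` for the renormalised
successor `G = g(Λ_q)` (res-type-060's wild trivialization p524471 + `subst_frobFamily_subst_conjMove`); then
`not_isSuccessorAt_of_frobCover` (successors of `G∘Θ` pulled back to the cover are orbit-substitution images of successors of
`h∘θ`, same `s`-order, same low-order terms) and the transfers back along `Θ` and `Λ_q` (p512731, p525479).  This is the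
`α = 0` case of the (open) same-rank wild stub (W-min); general ranks are NOT claimed. [OURS · L1 W4.3] -/
theorem gradedWonBy_zero_of_slice_wild (L : AddSubgroup (Fin (n + 1) → ℤ)) (F' : MvPowerSeries (Fin (n + 1)) k) (a : ℕ)
    (g : MvPowerSeries (Fin (n + 1 + 1)) k) (hfac : subst (CobordantGame.cruxChart k w c) F' = X 0 ^ a * g)
    (hc : c (Fin.last n) ≠ 0) (hw : 0 < w (Fin.last n)) (p e : ℕ) [Fact p.Prime] [CharP k p] (hq : q = p ^ e)
    (hv : q ∣ w (Fin.last n)) (hE : ((w (Fin.last n) / q : ℕ) : k) ≠ 0) (hmin : ∀ j, j ≠ Fin.last n → c j ≠ 0 → q ∣ w j) :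
    GradedWonBy 0 (n + 1) (sliceLattice (succLattice L w c) (Fin.last n)) (sliceGerm (Fin.last n) g) →
      GradedWonBy 0 (n + 1 + 1) (succLattice L w c) g := by
  classical
  intro hh
  haveI : CharP (MvPowerSeries (Fin (n + 1 + 1)) k) p := charP_of_injective_ringHom MvPowerSeries.C_injective p
  have hq0 : 0 < q := by rw [hq]; exact pow_pos (Nat.Prime.pos Fact.out) e
  have hfrob : ((1 : MvPowerSeries (Fin (n + 1 + 1)) k) + X (Fin.last (n + 1))) ^ q = 1 + X (Fin.last (n + 1)) ^ q := by
    rw [hq, add_pow_char_pow, one_pow]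
  set L' := succLattice L w c with hL'
  set h := sliceGerm (Fin.last n) g with hhdef
  have hgen : ∀ j : Fin (n + 1), c j ≠ 0 → 0 < w j → (Pi.single j.succ 1 : Fin (n + 1 + 1) → ℤ) ∈ L' :=
    fun j hcj hwj => AddSubgroup.subset_closure (Or.inr ⟨j, hcj, hwj, rfl⟩)
  have hlast : (Pi.single (Fin.last (n + 1)) 1 : Fin (n + 1 + 1) → ℤ) ∈ L' := by
    rw [← Fin.succ_last]; exact hgen _ hc hw
  have hdvd : ∀ j, c j ≠ 0 → 0 < w j → q ∣ w j := by
    intro j hcj hwj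
    by_cases hj : j = Fin.last n
    · subst hj; exact hv
    · exact hmin j hj hcj
  -- the one-move win of the slice
  rw [gradedWonBy_zero_iff] at hh
  obtain ⟨θ, W, ⟨⟨hθ0, hθdet, hWpos⟩, hθgr⟩, hno⟩ := hh
  have hθs : HasSubst θ := hasSubst_of_constantCoeff_zero hθ0
  -- the orbit exponents `ρ`, the shifted scaling `τ = ρ + q`, the inverse `u` of `1 + y_v`
  set ρ : Fin (n + 1) → ℕ := Fin.cases 1 fun j => resExp w q (Fin.castSucc j) with hρ
  set τ : Fin (n + 1) → ℕ := fun i => ρ i + q with hτ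
  have hρle : ∀ i, ρ i ≤ q := by
    intro i
    refine Fin.cases ?_ (fun j => ?_) i
    · simp only [hρ, Fin.cases_zero]; exact hq0
    · simp only [hρ, Fin.cases_succ]; exact (resExp_lt w q hq0 _).le
  obtain ⟨u, hu1, hu0, hu⟩ := exists_inv_one_add_X (k := k) (Fin.last (n + 1))
  -- the divisibility data of the graded monomials of `θ`
  have hdiv : ∀ i d, coeff d (θ i) ≠ 0 → ρ i ≤ tauDeg τ d ∧ q ∣ tauDeg τ d - ρ i := by
    intro i d hd
    have hd0 : d ≠ 0 := by
      rintro rfl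
      exact hd (by rw [coeff_zero_eq_constantCoeff_apply]; exact hθ0 i)
    obtain ⟨i₀, hi₀⟩ : ∃ i₀, d i₀ ≠ 0 := by
      by_contra hcon; push Not at hcon; exact hd0 (Finsupp.ext hcon)
    have hle : ρ i ≤ tauDeg τ d := by
      unfold tauDeg
      have h1 : ρ i ≤ τ i₀ * d i₀ := by
        have : 1 ≤ d i₀ := Nat.one_le_iff_ne_zero.mpr hi₀
        have hτi : τ i₀ = ρ i₀ + q := rfl
        rw [hτi]
        nlinarith [hρle i]
      exact h1.trans (Finset.single_le_sum (f := fun l => τ l * d l) (fun l _ => Nat.zero_le _) (Finset.mem_univ i₀))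
    refine ⟨hle, ?_⟩
    -- the congruence `Σ_l ρ_l (d_l − [l = i]) ≡ 0 (mod q)` from the weight functional on the propagated lattice
    have hmem := hθgr i d hd
    rw [mem_sliceLattice_last_iff] at hmem
    obtain ⟨v, hv', hvres⟩ := hmem
    have hz := weight_functional_modEq_zero w c q L hdvd v hv'
    have hvc : ∀ l : Fin (n + 1), (v (Fin.castSucc l) : ZMod q) = (d l : ZMod q) - ((Pi.single i (1 : ℤ) : Fin (n + 1) → ℤ) l : ZMod q) := by
      intro l
      have := congrFun hvres l
      simp only [Pi.sub_apply, expVec] at this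
      rw [this]; push_cast; rfl
    have hres : ∀ j : Fin (n + 1), ((resExp w q j : ℕ) : ZMod q) = -((w j : ℕ) : ZMod q) := by
      intro j
      have hr := resExp_add_eq w q hq0 j
      have : ((resExp w q j : ℕ) : ZMod q) + ((w j : ℕ) : ZMod q) = 0 := by
        rw [← Nat.cast_add, hr]; push_cast; rw [ZMod.natCast_self, zero_mul]
      linear_combination this
    have hwl : ((w (Fin.last n) : ℕ) : ZMod q) = 0 := (ZMod.natCast_eq_zero_iff _ _).mpr hv
    -- `hz` rewritten in terms of `d`
    have hz' : ((d 0 : ZMod q) - ((Pi.single i (1 : ℤ) : Fin (n + 1) → ℤ) 0 : ZMod q)) -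
        ∑ j : Fin n, ((w (Fin.castSucc j) : ℕ) : ZMod q) *
          ((d j.succ : ZMod q) - ((Pi.single i (1 : ℤ) : Fin (n + 1) → ℤ) j.succ : ZMod q)) = 0 := by
      have h := hz
      push_cast at h
      rw [Fin.sum_univ_castSucc, hwl, zero_mul, add_zero] at h
      have h0 : ((v 0 : ℤ) : ZMod q) = (d 0 : ZMod q) - ((Pi.single i (1 : ℤ) : Fin (n + 1) → ℤ) 0 : ZMod q) := by
        rw [← hvc 0]; rfl
      rw [h0] at h
      rw [Finset.sum_congr rfl (fun j _ => by rw [Fin.succ_castSucc, hvc j.succ])] at h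
      exact h
    -- the target sum
    have hT : (∑ l : Fin (n + 1), (ρ l : ZMod q) * ((d l : ZMod q) - ((Pi.single i (1 : ℤ) : Fin (n + 1) → ℤ) l : ZMod q))) = 0 := by
      rw [Fin.sum_univ_succ]
      simp only [hρ, Fin.cases_zero, Fin.cases_succ, Nat.cast_one, one_mul]
      rw [Finset.sum_congr rfl (fun j _ => by rw [hres (Fin.castSucc j)])]
      rw [← hz']
      simp only [neg_mul, Finset.sum_neg_distrib, sub_eq_add_neg]
    have hδ : (∑ l : Fin (n + 1), (ρ l : ZMod q) * ((Pi.single i (1 : ℤ) : Fin (n + 1) → ℤ) l : ZMod q)) = (ρ i : ZMod q) := by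
      rw [Finset.sum_eq_single i]
      · simp
      · intro l _ hl; rw [Pi.single_eq_of_ne hl]; simp
      · intro h; exact absurd (Finset.mem_univ _) h
    have hmain : ((tauDeg τ d : ℕ) : ZMod q) - (ρ i : ZMod q) = 0 := by
      have htau : ((tauDeg τ d : ℕ) : ZMod q) = ∑ l : Fin (n + 1), (ρ l : ZMod q) * (d l : ZMod q) := by
        unfold tauDeg
        push_cast
        refine Finset.sum_congr rfl fun l _ => ?_
        have hτl : τ l = ρ l + q := rfl
        rw [hτl]; push_cast; rw [ZMod.natCast_self]; ring
      rw [htau, ← hδ, ← Finset.sum_sub_distrib, ← hT]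
      exact Finset.sum_congr rfl fun l _ => by ring
    have hZ : ((tauDeg τ d - ρ i : ℕ) : ZMod q) = 0 := by
      rw [Nat.cast_sub hle]; exact hmain
    exact (ZMod.natCast_eq_zero_iff _ _).mp hZ
  -- the renormalised successor and its trivialization over the cover (res-type-060)
  set G := subst (wildLambda w c q) g with hG
  have hGcov : subst (frobFamily (k := k) n q) G =
      (1 + X (Fin.last (n + 1))) ^ a * subst (wildTw w q) (cylinder h) := by
    rw [hG, ← subst_wildLambdaFrob w c q hq0]
    exact subst_wildLambdaFrob_eq w c q hq0 hfrob hw hv hmin F' a g hfac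
  have hTw : ∀ i : Fin (n + 1), wildTw (k := k) w q (Fin.castSucc i) = (1 + X (Fin.last (n + 1))) ^ (ρ i) * X (Fin.castSucc i) := by
    intro i
    refine Fin.cases ?_ (fun j => ?_) i
    · rw [Fin.castSucc_zero, wildTw_zero]; simp [hρ]
    · rw [← Fin.succ_castSucc, wildTw_succ]; simp [hρ]
  -- the conjugate move
  set Θ := conjMove q ρ τ u θ with hΘ
  have hΘ0 : ∀ j, constantCoeff (Θ j) = 0 := constantCoeff_conjMove hθ0
  have hΘdet : IsUnit (Matrix.det (Matrix.of fun a b => coeff (Finsupp.single b 1) (Θ a))) := by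
    rw [hΘ, det_linMat_conjMove hu hu0]; exact hθdet
  have hΘgr := conjMove_graded (q := q) (ρ := ρ) (τ := τ) (u := u) (θ := θ) hq0 hfrob hu hu1 hdiv
    (sliceLattice L' (Fin.last n)) L' (cylLattice_sliceLattice_last_le L' hlast) hlast hθgr
  have hkey := subst_frobFamily_subst_conjMove hq0 hfrob hu hu1 hdiv hθ0 G h a (wildTw w q) (constantCoeff_wildTw w q) hTw hGcov
  -- `G∘Θ` has no singular successor under the pure move `(id, (W, 0))`
  obtain ⟨i₀, hi₀⟩ := hWpos
  have hH : ∀ (c' : Fin (n + 1) → k) (A : ℕ) (h₁ : MvPowerSeries (Fin (n + 1 + 1)) k), (∃ i, 0 < W i ∧ c' i ≠ 0) →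
      subst (CobordantGame.cruxChart k W c') (subst θ h) = X 0 ^ A * h₁ → ¬ X 0 ∣ h₁ →
      ¬ (constantCoeff h₁ = 0 ∧ ∀ j, coeff (Finsupp.single j 1) h₁ = 0) :=
    fun c' A h₁ hoff hf hnd hs => hno c' A h₁ ⟨hoff, hf, hnd, hs⟩
  have hwin : GradedWonBy 0 (n + 1 + 1) L' (subst Θ G) := by
    rw [gradedWonBy_zero_iff]
    refine ⟨fun i => X i, Fin.snoc W 0, isLGradedMove_X L' _ ⟨Fin.castSucc i₀, by simpa using hi₀⟩, ?_⟩
    exact not_isSuccessorAt_of_frobCover q hq0 τ a (subst Θ G) (subst θ h) hkey W hH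
  -- transport back along `Θ` (graded, invertible) and `Λ_q`
  obtain ⟨Θi, hΘi0, hΘi1, hΘi2⟩ := FormalCoordChange.exists_comp_inverse hΘ0 hΘdet
  have hΘs : HasSubst Θ := hasSubst_of_constantCoeff_zero hΘ0
  have hΘis : HasSubst Θi := hasSubst_of_constantCoeff_zero hΘi0
  have hback : subst Θi (subst Θ G) = G := by
    rw [subst_comp_subst_apply hΘs hΘis]
    have : (fun j => subst Θi (Θ j)) = X := by funext j; exact hΘi1 j
    rw [this, subst_self]; rfl
  have hGwin : GradedWonBy 0 (n + 1 + 1) L' G := by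
    have h5 := gradedWonBy_subst_of_leftInverse 0 L' (subst Θ G) Θi Θ hΘi0 hΘ0 hΘdet hΘgr hΘi2 hwin
    rwa [hback] at h5
  have hE' : ((ceilExp w q (Fin.last n) : ℕ) : k) ≠ 0 := by
    unfold ceilExp; rw [ceilDiv_of_dvd _ _ hq0 hv]; exact hE
  exact gradedWonBy_of_subst_wildLambda w c q 0 L' hlast hgen hc hE' g hGwin

end Main

end GradedGame

end Summit.ResolutionOfSingularities.ResolutionOfSingularities.Theorems
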